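import Literature.Geometry.Riemannian.HeatKernelPoincare
import Literature.Geometry.Riemannian.HeatGradientLogSubsolution
import HarnessLib

/-!
# The Hein–Naber log-Sobolev inequality for the conjugate heat kernel measures of a Ricci flow
# (Hein–Naber 2014, Thm. 1.10; Bamler 2020a, §12)

H.-J. Hein, A. Naber, *New logarithmic Sobolev inequalities and an ε-regularity theorem for the
Ricci flow*, Comm. Pure Appl. Math. 67 (2014), Thm. 1.10, and R. Bamler, *Entropy and heat kernel
bounds on a Ricci flow background*, arXiv:2008.07093 (2020a), §12 ("using [Hein–Naber-14]"):
for a Ricci flow on a closed manifold and the conjugate heat kernel measures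
`dν = dν_{x,t;s} = K(x,t;·,s) dg_s`, `s < t`, every positive `φ ∈ C¹(M)` satisfies the
log-Sobolev inequality in entropy (Fisher-information) form

  `∫ φ log φ dν − (∫ φ dν) log (∫ φ dν) ≤ (t − s) ∫ |∇φ|²_{g_s} / φ dν`.

This file proves it (for `C^∞` test functions `φ > 0`) for a Ricci flow `hflow = (h, cov)` on
`[a, T]` of a `C^∞` family of Riemannian metrics on a closed connected manifold `M` (modelled on
`ℝᵐ`), `a < s < t ≤ T`, with the tree's heat kernel measures
`ν_{x,t;s} = heatKernelMeasure hh hR t x s` (`HeatKernelMeasures.lean`), by the semigroup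
(Bakry–Émery / Hein–Naber §3.1) argument, exactly parallel to the Poincaré inequality of
`HeatKernelPoincare.lean`:

* `gradSq_div_heat_le_integral_heatKernelMeasure` — **Hein–Naber's Fisher-information bound
  `|∇P f|²/P f ≤ P(|∇f|²/f)`**: for a positive solution `u` of the heat equation
  `∂ᵣu = Δ_{h(r)}u` on `M × [s, t]` and `r ∈ (s, t]`,
  `|∇u(r)|²_{h(r)}(x)/u(r, x) ≤ ∫ |∇u(s)|²_{h(s)}/u(s) dν_{x,r;s}` (Hamilton's quotient
  `|∇u|²/u` is a sub-solution, `(∂ᵣ − Δ)(|∇u|²/u) = −(2/u)|Hess u − du ⊗ du/u|² ≤ 0`,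
  `derivWithin_gradSq_div_le_of_heat_ricciFlow`, and sub-solutions are dominated by the heat
  kernel measures, `integral_heatKernelMeasure_anti_of_subsolution`);
* `heinNaber_logSobolev_heatKernelMeasure` — **the log-Sobolev inequality** above: with
  `u = P φ > 0` and `ψ = P(|∇φ|²/φ)` the heat solutions from `φ`, `|∇φ|²_{h(s)}/φ` at time `s`,
  the function `w = −u log u − (r − s)ψ` satisfies `(∂ᵣ − Δ)w = |∇u|²/u − ψ ≤ 0` by the Fisher
  bound (`Δ(u log u) = |∇u|²/u + (log u + 1)Δu`), so `w(x, t) ≤ ∫ w(s) dν_{x,t;s}`, i.e.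
  `∫ φ log φ dν − u(x,t) log u(x,t) ≤ (t − s) ψ(x, t)` with `u(x, t) = ∫ φ dν`,
  `ψ(x, t) = ∫ |∇φ|²/φ dν` (representation formula).

Everything is proved; no definitions, no named facts. What is NOT here: the equivalent
`∇`-form `∫ φ² log φ² dν − (∫ φ² dν) log(∫ φ² dν) ≤ 4(t − s) ∫ |∇φ|² dν` for sign-changing `φ`
(Hein–Naber (1.14)), the Gaussian concentration / heat kernel bounds Bamler derives from it
(Bamler 2020a, Thm. 12.1 ff.), test functions of lower regularity (`C¹`, Lipschitz, `φ ≥ 0`),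
super Ricci flows and non-compact `M`.

## References

* H.-J. Hein, A. Naber, *New logarithmic Sobolev inequalities and an ε-regularity theorem for the
  Ricci flow*, Comm. Pure Appl. Math. 67 (2014), 1543–1561, Thm. 1.10 and §3.1. [HeinNaber2014]
* R. H. Bamler, *Entropy and heat kernel bounds on a Ricci flow background*, arXiv:2008.07093
  (2020), §4.2 (proof of Thm. 4.1), §12. [Bamler2020Entropy]
* D. Bakry, M. Émery, *Diffusions hypercontractives*, Sém. Probab. XIX, LNM 1123 (1985).
  [BakryEmery1985]
* R. S. Hamilton, *Three-manifolds with positive Ricci curvature*, J. Differential Geom. 17 (1982)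
  255–306, §11, Lemma 11.4. [Hamilton1982]
-/

noncomputable section

open Bundle Set Function Filter Manifold MeasureTheory Measure TopologicalSpace
open scoped Manifold ContDiff Topology ENNReal NNReal

namespace Literature.Geometry.Riemannian

open Lorentzian Lorentzian.PseudoRiemannianMetric

section LogSobolev

variable {m : ℕ} {H : Type*} [TopologicalSpace H]
  {I : ModelWithCorners ℝ (EuclideanSpace ℝ (Fin m)) H} [I.Boundaryless]
  {M : Type*} [TopologicalSpace M] [ChartedSpace H M] [IsManifold I ∞ M]
  [T2Space M] [CompactSpace M] [SecondCountableTopology M] [MeasurableSpace M] [BorelSpace M]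
  [PreconnectedSpace M]
  {h : ℝ → PseudoRiemannianMetric I ∞ (EuclideanSpace ℝ (Fin m)) (TangentSpace I : M → Type _)}
  {cov : ℝ → CovariantDerivative I (EuclideanSpace ℝ (Fin m)) (TangentSpace I : M → Type _)}
  {a T : ℝ}

omit [I.Boundaryless] [T2Space M] [CompactSpace M] [SecondCountableTopology M] [MeasurableSpace M]
  [BorelSpace M] [PreconnectedSpace M] in
/-- **The Laplacian of `f log f`**: `Δ_g(f log f)(x) = |∇f|²_g(x)/f(x) + (log f(x) + 1) Δ_g f(x)`
for `f` of class `C²` at `x` with `f(x) ≠ 0` (the chain rule `Δ(ζ ∘ f) = ζ''(f)|∇f|² + ζ'(f)Δf`,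
`dalembertian_real_comp`, with `ζ(v) = v log v`, `ζ' = log + 1`, `ζ'' = 1/v` away from `0`,
Mathlib's `Real.deriv_mul_log`, `Real.deriv2_mul_log`). [folklore] -/
private theorem laplaceBeltrami_fun_mul_log
    (g : PseudoRiemannianMetric I ∞ (EuclideanSpace ℝ (Fin m)) (TangentSpace I : M → Type _))
    {f : M → ℝ} {x : M} (hf : ContMDiffAt I 𝓘(ℝ, ℝ) 2 f x) (hx : f x ≠ 0) :
    g.laplaceBeltrami (fun y ↦ f y * Real.log (f y)) x =
      g.gradSq f x / f x + (Real.log (f x) + 1) * g.laplaceBeltrami f x := by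
  haveI := g.hasLeviCivita
  have hζ : ContDiffAt ℝ 2 (fun v : ℝ ↦ v * Real.log v) (f x) :=
    contDiffAt_id.mul (Real.contDiffAt_log.2 hx)
  have h1 : deriv (fun v : ℝ ↦ v * Real.log v) (f x) = Real.log (f x) + 1 :=
    Real.deriv_mul_log hx
  have h2 : deriv (deriv (fun v : ℝ ↦ v * Real.log v)) (f x) = (f x)⁻¹ :=
    Real.deriv2_mul_log (f x)
  rw [laplaceBeltrami_eq_dalembertian, laplaceBeltrami_eq_dalembertian,
    show (fun y ↦ f y * Real.log (f y)) = (fun v : ℝ ↦ v * Real.log v) ∘ f from rfl,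
    g.dalembertian_real_comp hf hζ, h2, h1]
  simp only [PseudoRiemannianMetric.gradSq, div_eq_inv_mul]

/-- **Hein–Naber's Fisher-information bound `|∇P f|²/P f ≤ P(|∇f|²/f)` for the heat equation
coupled with a Ricci flow** (Hein–Naber 2014, §3.1, proof of Thm. 1.10; Bamler 2020a, §4.2 and
§12; Hamilton's quotient trick): for a Ricci flow `(h, cov)` on `[a, T]` of a smooth family of
Riemannian metrics on a closed connected manifold, `a < s`, `t ≤ T`, a smooth POSITIVE solution
`u` of the heat equation `∂ᵣu = Δ_{h(r)}u` on `M × [s, t]`, `r ∈ (s, t]` and `x ∈ M`,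

  `|∇u(r)|²_{h(r)}(x) / u(r, x) ≤ ∫ |∇u(s)|²_{h(s)} / u(s) dν_{x,r;s}`

(`|∇u|²/u` is a sub-solution of the heat equation,
`(∂ᵣ − Δ)(|∇u|²/u) = −(2/u)|Hess u − du ⊗ du/u|² ≤ 0` under the flow,
`derivWithin_gradSq_div_le_of_heat_ricciFlow`, and sub-solutions are dominated by the heat kernel
measures, `integral_heatKernelMeasure_anti_of_subsolution` with `ν_{x,r;r} = δ_x`).
[cite: HeinNaber2014, §3.1, proof of Thm. 1.10] [cite: Bamler2020Entropy, §4.2, proof of Thm. 4.1]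
[cite: Hamilton1982, §11, Lemma 11.4] -/
theorem gradSq_div_heat_le_integral_heatKernelMeasure (hflow : IsRicciFlow h cov (Icc a T))
    (hh : IsContMDiffFamilyOn ∞ h univ) (hR : ∀ r, (h r).IsRiemannian) {s t : ℝ} (has : a < s)
    (htT : t ≤ T) {u : ℝ → M → ℝ} (hu : IsHeatSolutionOn h u s t)
    (hupos : ∀ r ∈ Icc s t, ∀ y : M, 0 < u r y) {r : ℝ} (hr : r ∈ Ioc s t) (x : M) :
    (h r).gradSq (u r) x / u r x ≤
      ∫ y, (h s).gradSq (u s) y / u s y ∂(heatKernelMeasure hh hR r x s) := by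
  have hsr : s < r := hr.1
  -- the flow and the solution restricted to `[s, r]`
  have hu' : IsHeatSolutionOn h u s r := hu.mono le_rfl hr.2
  have hflow' : IsRicciFlow h cov (Icc s r) :=
    hflow.mono (Icc_subset_Icc has.le (hr.2.trans htT))
  have hU : UniqueDiffOn ℝ (Icc s r) := uniqueDiffOn_Icc hsr
  have hupos' : ∀ r' ∈ Icc s r, ∀ y : M, 0 < u r' y := fun r' hr' y ↦
    hupos r' ⟨hr'.1, hr'.2.trans hr.2⟩ y
  -- `w(r', y) = |∇u(r')|²_{h(r')}(y) / u(r', y)` is a smooth sub-solution on `M × [s, r]`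
  have hW : ContMDiffOn (I.prod 𝓘(ℝ, ℝ)) 𝓘(ℝ, ℝ) ∞
      (fun p : M × ℝ ↦ (h p.2).gradSq (u p.2) p.1 / u p.2 p.1) (univ ×ˢ Icc s r) :=
    (hflow'.smooth.contMDiffOn_gradSq hU hu'.1).div₀ hu'.1 fun p hp ↦ (hupos' p.2 hp.2 p.1).ne'
  have hWsub : ∀ r' ∈ Icc s r, ∀ y : M,
      derivWithin (fun r'' ↦ (h r'').gradSq (u r'') y / u r'' y) (Icc s r) r' ≤
        (h r').laplaceBeltrami (fun z ↦ (h r').gradSq (u r') z / u r' z) y := fun r' hr' y ↦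
    derivWithin_gradSq_div_le_of_heat_ricciFlow hsr hflow' (fun r'' _ ↦ hR r'') hu'.1 hu'.2
      hupos' hr' y
  have key := integral_heatKernelMeasure_anti_of_subsolution hflow hh hR
    ⟨has.trans hsr, hr.2.trans htT⟩ x has hsr le_rfl
    (w := fun r' y ↦ (h r').gradSq (u r') y / u r' y) hW hWsub
  rwa [heatKernelMeasure_self, integral_dirac] at key

/-- **The Hein–Naber log-Sobolev inequality for the conjugate heat kernel measures of a Ricci
flow, entropy / Fisher-information form** (Hein–Naber 2014, Thm. 1.10; Bamler 2020a, §12): for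
a Ricci flow `(h, cov)` on `[a, T]` of a smooth family of Riemannian metrics on a closed
connected manifold `M`, `a < s < t ≤ T`, `x ∈ M`, the conjugate heat kernel measure
`ν = ν_{x,t;s}` and a smooth positive `φ : M → ℝ`,

  `∫ φ log φ dν − (∫ φ dν) log (∫ φ dν) ≤ (t − s) ∫ |∇φ|²_{h(s)} / φ dν`.

Proof (the semigroup argument of Hein–Naber §3.1 / Bakry–Émery): let `u`, `ψ` be the heat
solutions on `M × [s, t]` with `u(s) = φ`, `ψ(s) = |∇φ|²_{h(s)}/φ`; `u ≥ min φ > 0` by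
comparison with a constant solution (`IsHeatSolutionOn.le_of_le_initial`); by the Fisher bound
`gradSq_div_heat_le_integral_heatKernelMeasure` and the representation formula,
`|∇u(r)|²/u(r) ≤ ψ(r)` on `M × [s, t]`, so `w = −u log u + (s − r)ψ` satisfies
`(∂ᵣ − Δ_{h(r)})w = |∇u|²/u − ψ ≤ 0` (`∂ᵣ(u log u) = (log u + 1)Δu`,
`Δ(u log u) = |∇u|²/u + (log u + 1)Δu`), whence `w(x, t) ≤ ∫ w(s) dν_{x,t;s}`
(`integral_heatKernelMeasure_anti_of_subsolution`), i.e.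
`−u(x,t) log u(x,t) − (t − s) ψ(x,t) ≤ −∫ φ log φ dν` with `u(x, t) = ∫ φ dν`,
`ψ(x, t) = ∫ |∇φ|²/φ dν` (`IsHeatSolutionOn.eq_integral_heatKernelMeasure`).
[cite: HeinNaber2014, Thm. 1.10] [cite: Bamler2020Entropy, §12] -/
theorem heinNaber_logSobolev_heatKernelMeasure (hflow : IsRicciFlow h cov (Icc a T))
    (hh : IsContMDiffFamilyOn ∞ h univ) (hR : ∀ r, (h r).IsRiemannian) {s t : ℝ} (has : a < s)
    (hst : s < t) (htT : t ≤ T) (x : M) {φ : M → ℝ} (hφ : ContMDiff I 𝓘(ℝ, ℝ) ∞ φ)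
    (hφpos : ∀ y, 0 < φ y) :
    ∫ y, φ y * Real.log (φ y) ∂(heatKernelMeasure hh hR t x s) -
        (∫ y, φ y ∂(heatKernelMeasure hh hR t x s)) *
          Real.log (∫ y, φ y ∂(heatKernelMeasure hh hR t x s)) ≤
      (t - s) * ∫ y, (h s).gradSq φ y / φ y ∂(heatKernelMeasure hh hR t x s) := by
  have h2le : (2 : ℕ∞ω) ≤ ((⊤ : ℕ∞) : ℕ∞ω) := WithTop.coe_le_coe.mpr le_top
  have hU : UniqueDiffOn ℝ (Icc s t) := uniqueDiffOn_Icc hst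
  -- `φ ≥ c > 0` on the compact manifold `M`
  obtain ⟨c, hc, hcφ⟩ : ∃ c : ℝ, 0 < c ∧ ∀ y, c ≤ φ y := by
    haveI : Nonempty M := ⟨x⟩
    obtain ⟨y₀, -, hy₀⟩ :=
      isCompact_univ.exists_isMinOn univ_nonempty hφ.continuous.continuousOn
    exact ⟨φ y₀, hφpos y₀, isMinOn_univ_iff.1 hy₀⟩
  -- `|∇φ|²_{h(s)} / φ` is smooth
  have hGφ : ContMDiff I 𝓘(ℝ, ℝ) ∞ ((h s).gradSq φ) := by
    have hf : ContMDiffOn (I.prod 𝓘(ℝ, ℝ)) 𝓘(ℝ, ℝ) ∞ (fun p : M × ℝ ↦ φ p.1)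
        (univ ×ˢ (univ : Set ℝ)) := (hφ.comp contMDiff_fst).contMDiffOn
    exact contMDiff_slice_of_contMDiffOn (u := fun r y ↦ (h r).gradSq φ y)
      (hh.contMDiffOn_gradSq uniqueDiffOn_univ (f := fun _ y ↦ φ y) hf) (mem_univ s)
  have hFφ : ContMDiff I 𝓘(ℝ, ℝ) ∞ (fun y ↦ (h s).gradSq φ y / φ y) :=
    hGφ.div₀ hφ fun y ↦ (hφpos y).ne'
  -- the heat solutions `u = Pφ > 0` and `ψ = P(|∇φ|²/φ)` on `M × [s, t]`
  obtain ⟨u, hu, hus⟩ := exists_isHeatSolutionOn hh hR hst hφ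
  obtain ⟨ψ, hψ, hψs⟩ := exists_isHeatSolutionOn hh hR hst hFφ
  have hupos : ∀ r ∈ Icc s t, ∀ y : M, 0 < u r y := by
    intro r hr y
    have h1 := (isHeatSolutionOn_const (h := h) c s t).le_of_le_initial hR hst hu
      (fun z ↦ by rw [hus]; exact hcφ z) hr y
    exact hc.trans_le h1
  -- (1) the Fisher bound `|∇u(r)|²/u(r) ≤ ψ(r)` on `M × [s, t]`
  have hFle : ∀ r ∈ Icc s t, ∀ y : M, (h r).gradSq (u r) y / u r y ≤ ψ r y := by
    intro r hr y
    rcases eq_or_lt_of_le hr.1 with heq | hsr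
    · subst heq
      simp only [hψs, hus, le_refl]
    · have h1 := gradSq_div_heat_le_integral_heatKernelMeasure hflow hh hR has htT hu hupos
        ⟨hsr, hr.2⟩ y
      have h2 := (hψ.mono le_rfl hr.2).eq_integral_heatKernelMeasure hh hR hsr y
      simp only [hus] at h1
      simp only [hψs] at h2
      rwa [← h2] at h1
  -- (2) `w = −u log u + (s − r)ψ` is a smooth sub-solution of the heat equation on `M × [s, t]`
  have hwsmooth : ContMDiffOn (I.prod 𝓘(ℝ, ℝ)) 𝓘(ℝ, ℝ) ∞
      (fun p : M × ℝ ↦ -(u p.2 p.1 * Real.log (u p.2 p.1)) + (s - p.2) * ψ p.2 p.1)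
      (univ ×ˢ Icc s t) := by
    have hl : ContMDiffOn (I.prod 𝓘(ℝ, ℝ)) 𝓘(ℝ, ℝ) ∞ (fun p : M × ℝ ↦ s - p.2)
        (univ ×ˢ Icc s t) := (contMDiff_const.sub contMDiff_snd).contMDiffOn
    have hlog : ContMDiffOn (I.prod 𝓘(ℝ, ℝ)) 𝓘(ℝ, ℝ) ∞ (fun p : M × ℝ ↦ Real.log (u p.2 p.1))
        (univ ×ˢ Icc s t) := fun p hp ↦
      ContDiffAt.comp_contMDiffWithinAt (g := Real.log) (f := fun q : M × ℝ ↦ u q.2 q.1) (x := p)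
        (Real.contDiffAt_log.2 (hupos p.2 hp.2 p.1).ne') (hu.1 p hp)
    exact (hu.1.mul hlog).neg.add (hl.mul hψ.1)
  have hwsub : ∀ r ∈ Icc s t, ∀ y : M,
      derivWithin (fun r' ↦ -(u r' y * Real.log (u r' y)) + (s - r') * ψ r' y) (Icc s t) r ≤
        (h r).laplaceBeltrami (fun y ↦ -(u r y * Real.log (u r y)) + (s - r) * ψ r y) y := by
    intro r hr y
    have hur : ContMDiffAt I 𝓘(ℝ, ℝ) 2 (u r) y := ((hu.contMDiff_slice hr).of_le h2le).contMDiffAt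
    have hψr : ContMDiffAt I 𝓘(ℝ, ℝ) 2 (ψ r) y := ((hψ.contMDiff_slice hr).of_le h2le).contMDiffAt
    have hury : u r y ≠ 0 := (hupos r hr y).ne'
    -- the time derivative
    have hlin : HasDerivWithinAt (fun r' : ℝ ↦ s - r') (-1) (Icc s t) r :=
      (hasDerivWithinAt_id r _).const_sub s
    have hul : HasDerivWithinAt (fun r' ↦ u r' y * Real.log (u r' y))
        ((Real.log (u r y) + 1) * (h r).laplaceBeltrami (u r) y) (Icc s t) r := by
      have h0 := (Real.hasDerivAt_mul_log hury).comp_hasDerivWithinAt r (hu.2 r hr y)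
      exact h0
    have hd := hul.fun_neg.fun_add (hlin.fun_mul (hψ.2 r hr y))
    rw [hd.derivWithin (hU r hr)]
    -- the Laplacian
    have hΔ : (h r).laplaceBeltrami (fun y ↦ -(u r y * Real.log (u r y)) + (s - r) * ψ r y) y =
        -((h r).gradSq (u r) y / u r y + (Real.log (u r y) + 1) * (h r).laplaceBeltrami (u r) y) +
          (s - r) * (h r).laplaceBeltrami (ψ r) y := by
      have hulc : ContMDiffAt I 𝓘(ℝ, ℝ) 2 (fun y ↦ u r y * Real.log (u r y)) y :=
        hur.mul ((Real.contDiffAt_log.2 hury).comp_contMDiffAt hur)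
      rw [laplaceBeltrami_fun_add (h r) (f₁ := fun y ↦ -(u r y * Real.log (u r y)))
          (f₂ := fun y ↦ (s - r) * ψ r y) hulc.neg (contMDiffAt_const.mul hψr),
        laplaceBeltrami_const_mul (h r) hψr,
        show (fun y ↦ -(u r y * Real.log (u r y))) = -(fun y ↦ u r y * Real.log (u r y)) from rfl,
        laplaceBeltrami_neg, laplaceBeltrami_fun_mul_log (h r) hur hury]
    rw [hΔ]
    have hg := hFle r hr y
    linarith
  -- (3) domination of the sub-solution `w` by the heat kernel measures: `w(x,t) ≤ ∫ w(s) dν`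
  have key := integral_heatKernelMeasure_anti_of_subsolution hflow hh hR ⟨has.trans hst, htT⟩ x
    has hst le_rfl (w := fun r' y ↦ -(u r' y * Real.log (u r' y)) + (s - r') * ψ r' y) hwsmooth
    hwsub
  rw [heatKernelMeasure_self, integral_dirac, hu.eq_integral_heatKernelMeasure hh hR hst x,
    hψ.eq_integral_heatKernelMeasure hh hR hst x, hus, hψs] at key
  simp only [sub_self, zero_mul, add_zero, integral_neg] at key
  linarith

end LogSobolev

end Literature.Geometry.Riemannian
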